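import Mathlib
import Summits.MatrixMultiplication.MatrixMultiplication.Theorems.SnSubsetDichotomyNoThresholdSubsetTriplePlancherelStepDefs
import Summits.MatrixMultiplication.MatrixMultiplication.Theorems.SnSubsetDichotomyNoThresholdSubsetTripleTransProbInsert
import Summits.MatrixMultiplication.MatrixMultiplication.Theorems.SnSubsetDichotomyNoThresholdSubsetTripleIncrInsert
import Summits.MatrixMultiplication.MatrixMultiplication.Theorems.SnSubsetDichotomyNoThresholdSubsetTripleIncrInsertSucc
import Summits.MatrixMultiplication.MatrixMultiplication.Theorems.SnSubsetDichotomyNoThresholdSubsetTripleIncrLipschitz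
import Summits.MatrixMultiplication.MatrixMultiplication.Theorems.SnSubsetDichotomyNoThresholdSubsetTripleTransProbSum
import Summits.MatrixMultiplication.MatrixMultiplication.Theorems.SnSubsetDichotomyNoThresholdSubsetTripleAltCornerCharge

/-!
# (L2′): the square-root increment bound for `q` (route `SnSubsetDichotomy`)

Stub `sq_change_le` ((L2′) of the lead-c7 report, app. A) of line `klr-graded-polynomial-method`
(stmt-MatrixMultiplication-8302).

For a Young diagram `ν` (a finite lower set of cells) and an addable node `z`, the conditional
second moment `q(ν) = Σ_{y addable} p_y x_y²` of the J-increment under one Plancherel step changes,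
when the corner `z` is filled, by at most `6 √q(ν) + 11/3`.

Proof (assembly of the five landed ingredients).  Write `P`, `P⁺` for the addable nodes of `ν`,
`ν ∪ z`, `Pe = P ∖ {z}`, `N = P⁺ ∖ Pe ⊆ {z_E, z_S}` (`addableNodes_insert`, (F1)).  By the two mass
identities `Σ_{P⁺} p⁺ = 1 = Σ_P p` (Greene–Nijenhuis–Wilf, `transProb_sum_eq_one`),
`q⁺ − q = Σ_{y∈Pe} [p⁺_y (x⁺_y)² − p_y x_y² + (p_y − p⁺_y) x_z²] + Σ_{y∈N} p⁺_y ((x⁺_y)² − x_z²)`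
(an algebraic identity).
On `Pe`, `p⁺_y = p_y (1 + θ)`, `θ = 1/(h(h+2))` (F3, `transProb_insert_of_ne`), `x⁺_y = x_y ± 1`
(F2a, `incr_insert_of_ne`) and `|x_y − x_z| ≤ h + 1` (F5, `incr_sub_incr_abs_le`); with
`θ ≤ 1/3`, `θ (h+1) ≤ 2/3`, `θ (h+1)² ≤ 4/3` the bracket is at most `p_y (4|x_y| + 8/3)` in
absolute value.  On `N`, `x⁺ = x_z + ε'`, `|ε'| ≤ 1` (F2b, `incr_insert_succ`), so the term is at
most `p⁺ (2|x_z| + 1)`, and `Σ_N p⁺ ≤ p_z` by the mass identities and `p⁺ ≥ p` on `Pe`.  Summing,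
`|q⁺ − q| ≤ 4 Σ_P p_y |x_y| + 11/3 ≤ 4 √q + 11/3` (Cauchy–Schwarz with `Σ_P p = 1`).
-/

open scoped BigOperators
open Literature.RepresentationTheory.FiniteGroups (addableNodes IsAddableNode)

namespace Summit.MatrixMultiplication.MatrixMultiplication.Theorems

open PlancherelStep

/-! ### The corner sets before and after one growth step -/

set_option linter.dupNamespace false in
/-- Adding an addable node to a lower set of cells gives again a lower set. -/
private theorem isLowerSet_insert {ν : Finset (ℕ × ℕ)} (hν : IsLowerSet (ν : Set (ℕ × ℕ)))
    {z : ℕ × ℕ} (hz : IsAddableNode ν z) :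
    IsLowerSet ((insert z ν : Finset (ℕ × ℕ)) : Set (ℕ × ℕ)) := by
  obtain ⟨r, c⟩ := z
  obtain ⟨-, hup, hleft⟩ := hz
  dsimp only at hup hleft
  rintro ⟨a₁, a₂⟩ ⟨b₁, b₂⟩ hba ha
  obtain ⟨h₁, h₂⟩ := Prod.mk_le_mk.1 hba
  simp only [Finset.coe_insert, Set.mem_insert_iff, Finset.mem_coe, Prod.mk.injEq] at ha ⊢
  rcases ha with ⟨rfl, rfl⟩ | ha
  · by_cases hb : b₁ = a₁ ∧ b₂ = a₂
    · exact Or.inl hb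
    · refine Or.inr ?_
      rcases Nat.lt_or_ge b₁ a₁ with hlt | hge
      · exact Finset.mem_coe.1 (hν (Prod.mk_le_mk.2 ⟨Nat.le_sub_one_of_lt hlt, h₂⟩)
          (Finset.mem_coe.2 (hup.resolve_left (by omega))))
      · have hb₂ : b₂ < a₂ := by omega
        exact Finset.mem_coe.1 (hν (Prod.mk_le_mk.2 ⟨h₁, Nat.le_sub_one_of_lt hb₂⟩)
          (Finset.mem_coe.2 (hleft.resolve_left (by omega))))
  · exact Or.inr (Finset.mem_coe.1 (hν hba (Finset.mem_coe.2 ha)))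

set_option linter.dupNamespace false in
/-- Corner sets before/after filling the addable node `z` (from (F1) `addableNodes_insert`): every
old corner other than `z` stays addable, and the only possible new corners are `(z.1, z.2 + 1)` and
`(z.1 + 1, z.2)`. -/
private theorem addableNodes_insert_decomp {ν : Finset (ℕ × ℕ)} {z : ℕ × ℕ}
    (hz : IsAddableNode ν z) :
    (addableNodes ν).erase z ⊆ addableNodes (insert z ν) ∧
      ∀ x ∈ addableNodes (insert z ν) \ (addableNodes ν).erase z,
        x = (z.1, z.2 + 1) ∨ x = (z.1 + 1, z.2) := by
  obtain ⟨r, c⟩ := z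
  have hF := addableNodes_insert hz.1 hz.2.1 hz.2.2
  have hzP : (r, c) ∉ addableNodes (insert (r, c) ν) := fun h =>
    (Literature.RepresentationTheory.FiniteGroups.mem_addableNodes.1 h).1
      (Finset.mem_insert_self _ _)
  have hiff : ∀ x, x ∈ addableNodes ν ↔
      x ≠ (r, c + 1) ∧ x ≠ (r + 1, c) ∧ (x = (r, c) ∨ x ∈ addableNodes (insert (r, c) ν)) :=
    fun x => by rw [← hF, Finset.mem_erase, Finset.mem_erase, Finset.mem_insert]
  refine ⟨fun x hx => ?_, fun x hx => ?_⟩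
  · obtain ⟨hxz, hxP⟩ := Finset.mem_erase.1 hx
    exact ((hiff x).1 hxP).2.2.resolve_left hxz
  · obtain ⟨hxP', hxe⟩ := Finset.mem_sdiff.1 hx
    have hxz : x ≠ (r, c) := fun e => hzP (e ▸ hxP')
    by_contra h
    obtain ⟨h1, h2⟩ := not_or.1 h
    exact hxe (Finset.mem_erase.2 ⟨hxz, (hiff x).2 ⟨h1, h2, Or.inr hxP'⟩⟩)

/-! ### Real arithmetic -/

set_option linter.dupNamespace false in
/-- The mass factor `θ = 1/(h(h+2))` of (F3) satisfies `0 ≤ θ ≤ 1/3`, `θ (h+1) ≤ 2/3`,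
`θ (h+1)² ≤ 4/3` (for `h ≥ 1` by arithmetic, for `h = 0` because `1/0 = 0`). -/
private theorem theta_bounds (h : ℕ) :
    0 ≤ 1 / ((h : ℝ) * ((h : ℝ) + 2)) ∧ 1 / ((h : ℝ) * ((h : ℝ) + 2)) ≤ 1 / 3 ∧
      1 / ((h : ℝ) * ((h : ℝ) + 2)) * ((h : ℝ) + 1) ≤ 2 / 3 ∧
      1 / ((h : ℝ) * ((h : ℝ) + 2)) * ((h : ℝ) + 1) ^ 2 ≤ 4 / 3 := by
  rcases Nat.eq_zero_or_pos h with rfl | hpos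
  · norm_num
  have h1 : (1 : ℝ) ≤ h := by exact_mod_cast hpos
  have hden : (0 : ℝ) < (h : ℝ) * ((h : ℝ) + 2) := by positivity
  refine ⟨by positivity, ?_, ?_, ?_⟩
  · rw [div_le_div_iff₀ hden (by norm_num)]
    nlinarith
  · rw [div_mul_eq_mul_div, one_mul, div_le_div_iff₀ hden (by norm_num)]
    nlinarith
  · rw [div_mul_eq_mul_div, one_mul, div_le_div_iff₀ hden (by norm_num)]
    nlinarith

set_option linter.dupNamespace false in
/-- The far-corner bracket: if `|ε| = 1`, `0 ≤ θ ≤ 1/3`, `θ d ≤ 2/3`, `θ d² ≤ 4/3` and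
`|X − W| ≤ d`, then `|θ (X² − W²) + (1 + θ)(2 ε X + 1)| ≤ 4 |X| + 8/3`. -/
private theorem far_term_abs_le {X W ε θ d : ℝ} (hε : |ε| = 1) (hθ₀ : 0 ≤ θ) (hθ₁ : θ ≤ 1 / 3)
    (hθd : θ * d ≤ 2 / 3) (hθd₂ : θ * d ^ 2 ≤ 4 / 3) (hd : |X - W| ≤ d) :
    |θ * (X ^ 2 - W ^ 2) + (1 + θ) * (2 * ε * X + 1)| ≤ 4 * |X| + 8 / 3 := by
  have hsum : |X + W| ≤ 2 * |X| + d := by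
    have e : X + W = 2 * X - (X - W) := by ring
    rw [e]
    refine (abs_sub _ _).trans ?_
    rw [abs_mul, abs_two]
    exact add_le_add le_rfl hd
  have hd₀ : 0 ≤ d := (abs_nonneg _).trans hd
  have h1 : |θ * (X ^ 2 - W ^ 2)| ≤ 4 / 3 * |X| + 4 / 3 := by
    rw [abs_mul, abs_of_nonneg hθ₀, sq_sub_sq, abs_mul]
    calc θ * (|X + W| * |X - W|) ≤ θ * ((2 * |X| + d) * d) :=
          mul_le_mul_of_nonneg_left
            (mul_le_mul hsum hd (abs_nonneg _) (add_nonneg (by positivity) hd₀)) hθ₀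
      _ = 2 * |X| * (θ * d) + θ * d ^ 2 := by ring
      _ ≤ 2 * |X| * (2 / 3) + 4 / 3 :=
          add_le_add (mul_le_mul_of_nonneg_left hθd (by positivity)) hθd₂
      _ = 4 / 3 * |X| + 4 / 3 := by ring
  have h2 : |(1 + θ) * (2 * ε * X + 1)| ≤ 8 / 3 * |X| + 4 / 3 := by
    rw [abs_mul, abs_of_nonneg (by linarith)]
    have h3 : |2 * ε * X + 1| ≤ 2 * |X| + 1 := by
      refine (abs_add_le _ _).trans ?_
      rw [abs_mul, abs_mul, hε, abs_two, abs_one, mul_one]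
    calc (1 + θ) * |2 * ε * X + 1| ≤ (1 + 1 / 3) * (2 * |X| + 1) :=
          mul_le_mul (by linarith) h3 (abs_nonneg _) (by norm_num)
      _ = 8 / 3 * |X| + 4 / 3 := by ring
  calc _ ≤ |θ * (X ^ 2 - W ^ 2)| + |(1 + θ) * (2 * ε * X + 1)| := abs_add_le _ _
    _ ≤ _ := by linarith

set_option linter.dupNamespace false in
/-- The near-corner bracket: if `|ε| ≤ 1` then `|(W + ε)² − W²| ≤ 2 |W| + 1`. -/
private theorem near_term_abs_le {W ε : ℝ} (hε : |ε| ≤ 1) :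
    |(W + ε) ^ 2 - W ^ 2| ≤ 2 * |W| + 1 := by
  have e : (W + ε) ^ 2 - W ^ 2 = 2 * W * ε + ε * ε := by ring
  rw [e]
  refine (abs_add_le _ _).trans ?_
  rw [abs_mul, abs_mul, abs_two, abs_mul]
  have hε₀ := abs_nonneg ε
  have hW := abs_nonneg W
  nlinarith [mul_le_mul hε hε hε₀ zero_le_one, mul_le_mul_of_nonneg_left hε hW]

set_option linter.dupNamespace false in
/-- Cauchy–Schwarz for a probability vector: `Σ p |X| ≤ √(Σ p X²)`. -/
private theorem sum_mul_abs_le_sqrt {ι : Type*} (s : Finset ι) (p X : ι → ℝ)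
    (hp : ∀ i ∈ s, 0 ≤ p i) (hsum : ∑ i ∈ s, p i = 1) :
    ∑ i ∈ s, p i * |X i| ≤ Real.sqrt (∑ i ∈ s, p i * X i ^ 2) := by
  refine Real.le_sqrt_of_sq_le ?_
  calc (∑ i ∈ s, p i * |X i|) ^ 2 ≤ (∑ i ∈ s, p i) * ∑ i ∈ s, p i * X i ^ 2 :=
        Finset.sum_sq_le_sum_mul_sum_of_sq_le_mul s hp
          (fun i hi => mul_nonneg (hp i hi) (sq_nonneg _))
          (fun i _ => by rw [mul_pow, sq_abs]; exact le_of_eq (by ring))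
    _ = _ := by rw [hsum, one_mul]

set_option linter.dupNamespace false in
/-- The bookkeeping step.  Given the two mass identities, `p ≤ p⁺` on the old corners, the
far-corner bracket bound on `Pe` and the near-corner bound on `N`,
`|q⁺ − q| ≤ 4 (p_z |x_z| + Σ_{Pe} p |x|) + 11/3`. -/
private theorem assembly {ι : Type*} (Pe N : Finset ι) (p p' X X' : ι → ℝ) (pz Xz : ℝ)
    (hp : ∀ y ∈ Pe, 0 ≤ p y) (hp' : ∀ y ∈ N, 0 ≤ p' y) (hpz : 0 ≤ pz)
    (m1 : ∑ y ∈ N, p' y + ∑ y ∈ Pe, p' y = 1) (m2 : pz + ∑ y ∈ Pe, p y = 1)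
    (hmono : ∀ y ∈ Pe, p y ≤ p' y)
    (hT : ∀ y ∈ Pe, |p' y * X' y ^ 2 - p y * X y ^ 2 + (p y - p' y) * Xz ^ 2| ≤
      p y * (4 * |X y| + 8 / 3))
    (hU : ∀ y ∈ N, |X' y ^ 2 - Xz ^ 2| ≤ 2 * |Xz| + 1) :
    |(∑ y ∈ N, p' y * X' y ^ 2 + ∑ y ∈ Pe, p' y * X' y ^ 2) -
        (pz * Xz ^ 2 + ∑ y ∈ Pe, p y * X y ^ 2)| ≤
      4 * (pz * |Xz| + ∑ y ∈ Pe, p y * |X y|) + 11 / 3 := by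
  have key : (∑ y ∈ N, p' y * X' y ^ 2 + ∑ y ∈ Pe, p' y * X' y ^ 2) -
        (pz * Xz ^ 2 + ∑ y ∈ Pe, p y * X y ^ 2) =
      ∑ y ∈ Pe, (p' y * X' y ^ 2 - p y * X y ^ 2 + (p y - p' y) * Xz ^ 2) +
        ∑ y ∈ N, p' y * (X' y ^ 2 - Xz ^ 2) := by
    simp only [Finset.sum_add_distrib, Finset.sum_sub_distrib, sub_mul, mul_sub, ← Finset.sum_mul]
    linear_combination Xz ^ 2 * m1 - Xz ^ 2 * m2
  rw [key]
  have hNle : ∑ y ∈ N, p' y ≤ pz := by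
    have := Finset.sum_le_sum hmono
    linarith
  have hB1 : |∑ y ∈ Pe, (p' y * X' y ^ 2 - p y * X y ^ 2 + (p y - p' y) * Xz ^ 2)| ≤
      4 * ∑ y ∈ Pe, p y * |X y| + 8 / 3 * ∑ y ∈ Pe, p y := by
    refine (Finset.abs_sum_le_sum_abs _ _).trans ((Finset.sum_le_sum hT).trans (le_of_eq ?_))
    rw [Finset.mul_sum, Finset.mul_sum, ← Finset.sum_add_distrib]
    exact Finset.sum_congr rfl fun y _ => by ring
  have hB2 : |∑ y ∈ N, p' y * (X' y ^ 2 - Xz ^ 2)| ≤ 2 * (pz * |Xz|) + pz := by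
    refine (Finset.abs_sum_le_sum_abs _ _).trans ?_
    calc ∑ y ∈ N, |p' y * (X' y ^ 2 - Xz ^ 2)| ≤ ∑ y ∈ N, p' y * (2 * |Xz| + 1) :=
          Finset.sum_le_sum fun y hy => by
            rw [abs_mul, abs_of_nonneg (hp' y hy)]
            exact mul_le_mul_of_nonneg_left (hU y hy) (hp' y hy)
      _ = (∑ y ∈ N, p' y) * (2 * |Xz| + 1) := (Finset.sum_mul _ _ _).symm
      _ ≤ pz * (2 * |Xz| + 1) := mul_le_mul_of_nonneg_right hNle (by positivity)
      _ = 2 * (pz * |Xz|) + pz := by ring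
  have hS : 0 ≤ ∑ y ∈ Pe, p y * |X y| :=
    Finset.sum_nonneg fun y hy => mul_nonneg (hp y hy) (abs_nonneg _)
  have hXz : 0 ≤ pz * |Xz| := mul_nonneg hpz (abs_nonneg _)
  calc _ ≤ _ := abs_add_le _ _
    _ ≤ 4 * ∑ y ∈ Pe, p y * |X y| + 8 / 3 * ∑ y ∈ Pe, p y + (2 * (pz * |Xz|) + pz) :=
        add_le_add hB1 hB2
    _ ≤ _ := by linarith

set_option linter.dupNamespace false in
/-- Row-parity charges are `0` or `±1`. -/
private theorem abs_rowCharge_cast_le (ν : Finset (ℕ × ℕ)) (i : ℕ) : |(rowCharge ν i : ℝ)| ≤ 1 := by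
  unfold rowCharge
  split_ifs <;> simp

set_option linter.dupNamespace false in
/-- Column-parity charges are `0` or `±1`. -/
private theorem abs_colCharge_cast_le (ν : Finset (ℕ × ℕ)) (j : ℕ) : |(colCharge ν j : ℝ)| ≤ 1 := by
  unfold colCharge
  split_ifs <;> simp

/-! ### The theorem -/

set_option linter.dupNamespace false in
/-- **(L2′) The square-root increment bound.** For a Young diagram `ν` (a finite lower set of
cells) and an addable node `z`, filling the corner `z` changes the conditional second moment
`q(ν) = Σ_{y addable} p_y x_y²` of the J-increment by at most `6 √q(ν) + 11/3` (in fact by at most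
`4 Σ_y p_y |x_y| + 11/3 ≤ 4 √q + 11/3`): assembly of the mass factor (F3), the increment updates
(F2a), (F2b), the taxicab-Lipschitz bound (F5), the corner-set update (F1) and the
Greene–Nijenhuis–Wilf identity `Σ p = 1`, followed by Cauchy–Schwarz. [lead c7 report, app. A] -/
theorem sq_change_le : ∀ (ν : Finset (ℕ × ℕ)), IsLowerSet (ν : Set (ℕ × ℕ)) →
    ∀ (z : ℕ × ℕ), z ∈ addableNodes ν →
      |sqEnergy (insert z ν) - sqEnergy ν| ≤ 6 * Real.sqrt (sqEnergy ν) + 11 / 3 := by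
  intro ν hν z hz
  have hzA : IsAddableNode ν z := Literature.RepresentationTheory.FiniteGroups.mem_addableNodes.1 hz
  have hν' := isLowerSet_insert hν hzA
  obtain ⟨hsub, hN⟩ := addableNodes_insert_decomp hzA
  -- Cauchy–Schwarz: `Σ p |x| ≤ √q`
  have hS : ∑ y ∈ addableNodes ν, transProb ν y * |(incr ν y : ℝ)| ≤ Real.sqrt (sqEnergy ν) := by
    unfold sqEnergy
    exact sum_mul_abs_le_sqrt _ (fun y => transProb ν y) (fun y => (incr ν y : ℝ))
      (fun y _ => transProb_nonneg ν y) (transProb_sum_eq_one ν hν)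
  -- the two mass identities
  have hm1 : ∑ y ∈ addableNodes (insert z ν) \ (addableNodes ν).erase z, transProb (insert z ν) y +
      ∑ y ∈ (addableNodes ν).erase z, transProb (insert z ν) y = 1 := by
    rw [Finset.sum_sdiff hsub]
    exact transProb_sum_eq_one _ hν'
  have hm2 : transProb ν z + ∑ y ∈ (addableNodes ν).erase z, transProb ν y = 1 := by
    rw [Finset.add_sum_erase _ _ hz]
    exact transProb_sum_eq_one _ hν
  -- `p ≤ p⁺` on the old corners (F3)
  have hmono : ∀ y ∈ (addableNodes ν).erase z, transProb ν y ≤ transProb (insert z ν) y := by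
    intro y hy
    obtain ⟨hne, hyP⟩ := Finset.mem_erase.1 hy
    rw [transProb_insert_of_ne ν hν y z hyP hz hne]
    exact le_mul_of_one_le_right (transProb_nonneg ν y) (le_add_of_nonneg_right (by positivity))
  -- the far-corner brackets (F3, F2a, F5)
  have hT : ∀ y ∈ (addableNodes ν).erase z,
      |transProb (insert z ν) y * (incr (insert z ν) y : ℝ) ^ 2 -
            transProb ν y * (incr ν y : ℝ) ^ 2 +
          (transProb ν y - transProb (insert z ν) y) * (incr ν z : ℝ) ^ 2| ≤
        transProb ν y * (4 * |(incr ν y : ℝ)| + 8 / 3) := by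
    intro y hy
    obtain ⟨hne, hyP⟩ := Finset.mem_erase.1 hy
    have hF3 := transProb_insert_of_ne ν hν y z hyP hz hne
    have hF2 := incr_insert_of_ne ν hν y z hyP hz hne
    have hF5 := (Int.cast_le (R := ℝ)).2 (incr_sub_incr_abs_le ν y z)
    rw [Int.cast_abs, Int.cast_sub, Int.cast_natCast] at hF5
    generalize hh : Int.natAbs ((y.1 : ℤ) - z.1) + Int.natAbs ((y.2 : ℤ) - z.2) - 1 = h at hF3
    have hd : ((Int.natAbs ((y.1 : ℤ) - z.1) + Int.natAbs ((y.2 : ℤ) - z.2) : ℕ) : ℝ) ≤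
        (h : ℝ) + 1 := by
      have hd' : Int.natAbs ((y.1 : ℤ) - z.1) + Int.natAbs ((y.2 : ℤ) - z.2) ≤ h + 1 := by omega
      exact_mod_cast hd'
    generalize hε : (if y.1 < z.1 then (-1 : ℤ) ^ (z.1 + z.2) else -(-1 : ℤ) ^ (z.1 + z.2)) = ε
      at hF2
    have hεa : |(ε : ℝ)| = 1 := by
      rw [← hε]
      split_ifs <;> simp
    have hε2 : (ε : ℝ) ^ 2 = 1 := by rw [← sq_abs, hεa, one_pow]
    obtain ⟨hθ₀, hθ₁, hθ₂, hθ₃⟩ := theta_bounds h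
    generalize hθ : 1 / ((h : ℝ) * ((h : ℝ) + 2)) = θ at hF3 hθ₀ hθ₁ hθ₂ hθ₃
    have hp₀ := transProb_nonneg ν y
    rw [hF3, hF2, Int.cast_add]
    have e : transProb ν y * (1 + θ) * ((incr ν y : ℝ) + ε) ^ 2 -
          transProb ν y * (incr ν y : ℝ) ^ 2 +
        (transProb ν y - transProb ν y * (1 + θ)) * (incr ν z : ℝ) ^ 2 =
      transProb ν y * (θ * ((incr ν y : ℝ) ^ 2 - (incr ν z : ℝ) ^ 2) +
        (1 + θ) * (2 * ε * (incr ν y : ℝ) + 1)) := by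
      linear_combination transProb ν y * (1 + θ) * hε2
    rw [e, abs_mul, abs_of_nonneg hp₀]
    exact mul_le_mul_of_nonneg_left (far_term_abs_le hεa hθ₀ hθ₁ hθ₂ hθ₃ (hF5.trans hd)) hp₀
  -- the near-corner brackets (F2b)
  have hU : ∀ y ∈ addableNodes (insert z ν) \ (addableNodes ν).erase z,
      |(incr (insert z ν) y : ℝ) ^ 2 - (incr ν z : ℝ) ^ 2| ≤ 2 * |(incr ν z : ℝ)| + 1 := by
    intro y hy
    obtain ⟨h₁, h₂⟩ := incr_insert_succ ν hν z hz
    rcases hN y hy with rfl | rfl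
    · rw [h₁, Int.cast_add]
      exact near_term_abs_le (abs_colCharge_cast_le ν _)
    · rw [h₂, Int.cast_sub, sub_eq_add_neg]
      exact near_term_abs_le ((abs_neg _).trans_le (abs_rowCharge_cast_le ν _))
  -- bookkeeping
  have hmain : |sqEnergy (insert z ν) - sqEnergy ν| ≤
      4 * ∑ y ∈ addableNodes ν, transProb ν y * |(incr ν y : ℝ)| + 11 / 3 := by
    unfold sqEnergy
    rw [← Finset.sum_sdiff hsub, ← Finset.add_sum_erase _ _ hz, ← Finset.add_sum_erase _ _ hz]
    exact assembly _ _ (fun y => transProb ν y) (fun y => transProb (insert z ν) y)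
      (fun y => (incr ν y : ℝ)) (fun y => (incr (insert z ν) y : ℝ)) (transProb ν z) (incr ν z : ℝ)
      (fun y _ => transProb_nonneg ν y) (fun y _ => transProb_nonneg _ y) (transProb_nonneg ν z)
      hm1 hm2 hmono hT hU
  have hq := Real.sqrt_nonneg (sqEnergy ν)
  linarith

end Summit.MatrixMultiplication.MatrixMultiplication.Theorems
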